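import Literature.Computability.Cryptography.ShorAssembly
import Literature.Computability.Complexity.OracleComputations
import HarnessLib

/-!
# Shor's classical reduction as an oracle computation

Trunk `PQC` (Literature/Computability/Cryptography), continuing `ShorFactoring.lean` (the
classical part `Shor1997.shorClassical` of Shor's factoring algorithm, written with *the true
order* `orderOf` in place of the order-finding subroutine) and `ShorAssembly.lean` (where the
programming fact `shorClassical_mem_FPRel : shorClassical ∈ FP^{orderBitLang}` is one of the six
named facts feeding `factoring_mem_FBQP_of`).

This file performs the machine-independent half of that programming fact. We write the
classical part once more, now as an *oracle computation* (`Literature.Computability.Complexity.OracleComp`, the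
query/answer tree of an oracle Turing machine computation, `OracleComputations.lean`) that
obtains each order `ord_m(x)` it needs by asking the order-bit oracle the `size m` bit queries
`((x, m), i)`, `i < size m`:

* `Shor1997.orderQ x m B` — ask the bits `i < B` of the order and assemble them;
  `Shor1997.splitStepM`, `wstepM`, `wrunM`, `shorDriverM`, `shorComp` — the oracle versions
  of `splitStep`, `wstep`, `wrun`, `shorDriver`, `shorClassical` of `ShorFactoring.lean`;
* `Shor1997.eval_shorComp` — **answered by the order-bit oracle `orderBitLang`, the
  computation returns `shorClassical`** (the order branch of `splitStep` is only reached on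
  Shor's promise `1 < m`, `gcd(x, m) = 1`, where the oracle answers truthfully, and
  `ord_m(x) < m < 2 ^ size m`);
* `Shor1997.queryCount_shorComp_le`, `Shor1997.length_le_of_mem_queryList_shorComp` — it asks
  at most `64 (L+1)³` queries, each of length `≤ 7L + 13`, `L ≤ |w|` the length of the number;
* `shorComp_isPolyTime` — the remaining **programming fact**: the transcript step function of
  `shorComp` (`OracleComp.toOracleAlg`) is polynomial-time (`OracleAlg.IsPolyTime`);
* `shorClassical_mem_FPRel_of` — **`shorComp_isPolyTime → shorClassical_mem_FPRel`**
  (`OracleComp.run_toOracleAlg`, `OracleComp.queries_toOracleAlg`).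

So `shorClassical_mem_FPRel` is reduced to the polynomial-time computability of one explicit
string function, to be programmed with the stack-program toolkit (`StackPrograms.lean`).

## References

* P. W. Shor, *Polynomial-time algorithms for prime factorization and discrete logarithms on a
  quantum computer*, SIAM J. Comput. 26 (1997) 1484–1509, §5 (pp. 15–16 of arXiv
  quant-ph/9508027v2: the classical reduction around order finding is polynomial time).
* S. Arora, B. Barak, *Computational Complexity: A Modern Approach*, CUP 2009, §3.4 (oracle
  machines), §17.2 (`FP^O`).
-/

namespace Literature.Computability.Complexity.OracleComp

variable {β γ : Type}

/-- The queries of a `bind` are those of the first computation followed by those of the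
continuation at its result. [folklore] -/
theorem queryList_bind (O : Oracle) (c : OracleComp β) (f : β → OracleComp γ) :
    queryList O (OracleComp.bind c f) = queryList O c ++ queryList O (f (eval O c)) := by
  induction c with
  | pure b => rfl
  | query q k ih => simp only [OracleComp.bind, queryList, eval, List.cons_append]; exact congrArg _ (ih _)

/-- A leaf asks nothing. [folklore] -/
@[simp] theorem queryList_pure' (O : Oracle) (b : β) : queryList O (OracleComp.pure b) = [] := rfl

/-- A single query asks itself. [folklore] -/
@[simp] theorem queryList_ask (O : Oracle) (q : List Bool) : queryList O (ask q) = [q] := rfl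

end Literature.Computability.Complexity.OracleComp

namespace Literature.Computability.Cryptography

open _root_.Computability Nat Complexity Cryptography Complexity.OracleComp

/-! ### Binary numerals: `encodeNat = Nat.bits` -/

/-- `encodePosNum p` is the list of binary digits of `p`, least significant first. [folklore] -/
theorem encodePosNum_eq_bits (p : PosNum) : encodePosNum p = (p : ℕ).bits := by
  induction p with
  | one => simp [encodePosNum]
  | bit1 p ih =>
    rw [encodePosNum, ih, PosNum.cast_bit1, ← Nat.bit1_bits, two_mul]
  | bit0 p ih =>
    rw [encodePosNum, ih, PosNum.cast_bit0, ← Nat.bit0_bits _ (PosNum.cast_pos p).ne']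
    congr 1; omega

/-- `encodeNat n` is the list of binary digits of `n`, least significant first (`Nat.bits`).
[folklore] -/
theorem encodeNat_eq_bits (n : ℕ) : encodeNat n = n.bits := by
  unfold encodeNat encodeNum
  cases h : (n : Num) with
  | zero =>
    have : n = 0 := by simpa using congrArg (fun m : Num => (m : ℕ)) h
    subst this; simp
  | pos p =>
    have : n = (p : ℕ) := by
      have := congrArg (fun m : Num => (m : ℕ)) h
      simpa using this
    rw [this]; exact encodePosNum_eq_bits p

/-- `|encodeNat n| = size n`. [folklore] -/
theorem length_encodeNat (n : ℕ) : (encodeNat n).length = n.size := by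
  rw [encodeNat_eq_bits, Nat.size_eq_bits_len]

/-- `|encodeNat n| ≤ B` as soon as `n < 2 ^ B`. [folklore] -/
theorem length_encodeNat_le_of_lt {n B : ℕ} (h : n < 2 ^ B) : (encodeNat n).length ≤ B := by
  rw [length_encodeNat]; exact Nat.size_le.2 h

namespace Shor1997

/-! ### Assembling a number from oracle answer bits -/

/-- The number whose binary digits (least significant first) are read off a list of oracle
answers, the answer `[true]` (`encodeBool true`) being the digit `1` and anything else `0`.
[folklore] -/
def ofAnswerBits (as : List (List Bool)) : ℕ :=
  Nat.ofDigits 2 (as.map fun a => (decide (a = [true])).toNat)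

/-- Bit `i` of the assembled number is read off answer `i`. [folklore] -/
theorem testBit_ofAnswerBits (as : List (List Bool)) (i : ℕ) :
    (ofAnswerBits as).testBit i = decide (as[i]? = some [true]) := by
  induction as generalizing i with
  | nil => simp [ofAnswerBits]
  | cons a as ih =>
    have hval : ofAnswerBits (a :: as) = Nat.bit (decide (a = [true])) (ofAnswerBits as) := by
      simp only [ofAnswerBits, List.map_cons, Nat.ofDigits_cons, Nat.bit_val]
      ring
    cases i with
    | zero => rw [hval, Nat.testBit_bit_zero]; simp
    | succ i => rw [hval, Nat.testBit_bit_succ, ih]; simp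

/-- Reading the bits `i < B` of `r < 2 ^ B` reassembles `r`. [folklore] -/
theorem ofAnswerBits_map_testBit {r B : ℕ} (hr : r < 2 ^ B) :
    ofAnswerBits ((List.range B).map fun i => encodeBool (r.testBit i)) = r := by
  refine Nat.eq_of_testBit_eq fun i => ?_
  rw [testBit_ofAnswerBits]
  by_cases hi : i < B
  · simp only [List.getElem?_map, List.getElem?_range hi, Option.map_some]
    cases r.testBit i <;> simp [encodeBool]
  · have h1 : ((List.range B).map fun i => encodeBool (r.testBit i))[i]? = none := by
      simp [not_lt.1 hi]
    rw [h1, Nat.testBit_eq_false_of_lt (hr.trans_le (Nat.pow_le_pow_right (by norm_num) (not_lt.1 hi)))]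
    simp

/-! ### The order query -/

/-- **The order query**: ask the order-bit oracle for the bits `i < B` of `ord_m(x)` (queries
`((x, m), i)` in the encoding `orderQueryEncoding`) and assemble them. Shor: the order is
obtained from the quantum order-finding subroutine; here that subroutine is the oracle.
[cite: Shor1997SICOMP, §5 p.15 (order finding as the quantum subroutine)] -/
def orderQ (x m B : ℕ) : OracleComp ℕ :=
  OracleComp.bind (forEach (fun i => ask (orderQueryEncoding.encode ((x, m), i))) (List.range B))
    fun as => OracleComp.pure (ofAnswerBits as)

/-- The order-bit oracle answers the query `((x, m), i)` on the promise by bit `i` of the order.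
[folklore] -/
theorem ofLanguage_orderBitLang_encode {x m : ℕ} (hm : 1 < m) (hx : x.Coprime m) (i : ℕ) :
    Oracle.ofLanguage orderBitLang (orderQueryEncoding.encode ((x, m), i)) =
      encodeBool ((orderOf (x : ZMod m)).testBit i) := by
  unfold Oracle.ofLanguage
  congr 1
  rw [← orderBit_eq_true_iff_indicator]
  · unfold orderBit
    rw [orderQueryEncoding.decode_encode]
    have hx' : Nat.gcd x m = 1 := hx
    simp [hm, Nat.Coprime, hx']
where
  /-- `boolIndicator` of `orderBitLang` is `orderBit`. -/
  orderBit_eq_true_iff_indicator : ∀ w, orderBit w = orderBitLang.boolIndicator w := by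
    intro w
    unfold Set.boolIndicator
    split
    · rename_i hw; exact (orderBit_eq_true_iff w).2 hw
    · rename_i hw; exact Bool.eq_false_iff.2 fun h => hw ((orderBit_eq_true_iff w).1 h)

/-- **The order query returns the order** when answered by the order-bit oracle, on the
promise and for `ord_m(x) < 2 ^ B`. [cite: Shor1997SICOMP, §5 p.15 (order finding)] -/
theorem eval_orderQ {x m B : ℕ} (hm : 1 < m) (hx : x.Coprime m) (hB : orderOf (x : ZMod m) < 2 ^ B) :
    eval (Oracle.ofLanguage orderBitLang) (orderQ x m B) = orderOf (x : ZMod m) := by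
  simp only [orderQ, eval_bind, eval_forEach, eval]
  have : (List.range B).map (fun i => eval (Oracle.ofLanguage orderBitLang)
      (ask (orderQueryEncoding.encode ((x, m), i)))) =
      (List.range B).map fun i => encodeBool ((orderOf (x : ZMod m)).testBit i) := by
    refine List.map_congr_left fun i _ => ?_
    simp only [ask, eval]
    exact ofLanguage_orderBitLang_encode hm hx i
  rw [this, ofAnswerBits_map_testBit hB]

/-- The order query asks `B` queries (whatever the oracle). [folklore] -/
theorem queryCount_orderQ (O : Oracle) (x m B : ℕ) : queryCount O (orderQ x m B) = B := by
  simp only [orderQ, queryCount_bind, queryCount, add_zero, queryCount_forEach]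
  have : ((List.range B).map fun i => queryCount O (ask (orderQueryEncoding.encode ((x, m), i)))) =
      (List.range B).map fun _ => 1 := List.map_congr_left fun i _ => by simp [ask, queryCount]
  rw [this]; simp

/-- The queries of the order query are the `B` bit queries (whatever the oracle). [folklore] -/
theorem queryList_orderQ (O : Oracle) (x m B : ℕ) :
    queryList O (orderQ x m B) = (List.range B).map fun i => orderQueryEncoding.encode ((x, m), i) := by
  simp only [orderQ, queryList_bind, queryList_pure', List.append_nil]
  suffices h : ∀ l : List ℕ,
      queryList O (forEach (fun i => ask (orderQueryEncoding.encode ((x, m), i))) l) =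
        l.map fun i => orderQueryEncoding.encode ((x, m), i) from h _
  intro l
  induction l with
  | nil => rfl
  | cons i l ih =>
    simp only [forEach, queryList_bind, queryList_ask, ih, queryList_pure', List.append_nil,
      List.map_cons, List.singleton_append]

/-! ### One attempt at splitting a number, with the order from the oracle -/

/-- Oracle version of `splitStep`: identical, except that in the last branch the order `r` of the
unit `x` modulo `m` is obtained by the order query with `B = size m` bits.
[cite: Shor1997SICOMP, §5 p.16 (reduction of factoring to order finding)] -/
def splitStepM (m X : ℕ) : OracleComp (Option ℕ) :=
  if Even m then OracleComp.pure (if m = 2 then none else some 2)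
  else if ppBase m < m then OracleComp.pure (some (ppBase m))
  else
    let x := X % 2 ^ Nat.size m
    if x = 0 ∨ m ≤ x then OracleComp.pure none
    else if 1 < Nat.gcd x m then OracleComp.pure (some (Nat.gcd x m))
    else OracleComp.bind (orderQ x m m.size) fun r =>
      OracleComp.pure (if Even r ∧ ¬ m ∣ x ^ (r / 2) + 1 then some (Nat.gcd (x ^ (r / 2) - 1) m) else none)

/-- The order of a unit modulo `m > 1` is `< 2 ^ size m` (indeed `< m`). [folklore] -/
theorem orderOf_lt_two_pow_size {m : ℕ} (hm : 1 < m) (x : ℕ) : orderOf (x : ZMod m) < 2 ^ m.size := by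
  haveI : NeZero m := ⟨by omega⟩
  have h1 : orderOf (x : ZMod m) ≤ Fintype.card (ZMod m) := orderOf_le_card_univ
  rw [ZMod.card] at h1
  exact h1.trans_lt (Nat.lt_size_self m)

/-- The order branch of `splitStep` is reached only for `m > 1`. [folklore] -/
theorem one_lt_of_orderBranch {m X : ℕ} (he : ¬ Even m) (h0 : ¬ (X % 2 ^ m.size = 0 ∨ m ≤ X % 2 ^ m.size)) :
    1 < m := by
  rcases Nat.lt_or_ge 1 m with h | h
  · exact h
  · exfalso
    interval_cases m
    · exact he (by decide)
    · simp only [not_or, not_le] at h0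
      have : X % 2 ^ Nat.size 1 < 2 := by
        rw [show Nat.size 1 = 1 from rfl]; exact Nat.mod_lt _ (by norm_num)
      omega

/-- **The oracle version of one attempt agrees with `splitStep`** when answered by the order-bit
oracle: the order branch is reached only for `1 < m` and `gcd(x, m) = 1`, i.e. on the promise.
[cite: Shor1997SICOMP, §5 p.16 (reduction of factoring to order finding)] -/
theorem eval_splitStepM (m X : ℕ) :
    eval (Oracle.ofLanguage orderBitLang) (splitStepM m X) = splitStep m X := by
  unfold splitStepM splitStep
  by_cases he : Even m
  · simp [he]
  simp only [if_neg he]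
  by_cases hpp : ppBase m < m
  · simp [hpp]
  simp only [if_neg hpp]
  by_cases h0 : X % 2 ^ m.size = 0 ∨ m ≤ X % 2 ^ m.size
  · simp [h0]
  simp only [if_neg h0]
  by_cases hg : 1 < Nat.gcd (X % 2 ^ m.size) m
  · simp [hg]
  simp only [if_neg hg, eval_bind, eval]
  have hm : 1 < m := one_lt_of_orderBranch he h0
  have hcop : (X % 2 ^ m.size).Coprime m := by
    have hpos : 0 < Nat.gcd (X % 2 ^ m.size) m := Nat.gcd_pos_of_pos_right _ (by omega)
    unfold Nat.Coprime; omega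
  rw [eval_orderQ hm hcop (orderOf_lt_two_pow_size hm _)]

/-- One attempt asks at most `size m` queries (whatever the oracle). [folklore] -/
theorem queryCount_splitStepM_le (O : Oracle) (m X : ℕ) : queryCount O (splitStepM m X) ≤ m.size := by
  unfold splitStepM
  by_cases he : Even m
  · simp [he]
  simp only [if_neg he]
  by_cases hpp : ppBase m < m
  · simp [hpp]
  simp only [if_neg hpp]
  by_cases h0 : X % 2 ^ m.size = 0 ∨ m ≤ X % 2 ^ m.size
  · simp [h0]
  simp only [if_neg h0]
  by_cases hg : 1 < Nat.gcd (X % 2 ^ m.size) m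
  · simp [hg]
  simp [if_neg hg, queryCount_bind, queryCount, queryCount_orderQ]

/-- The queries of one attempt are order-bit queries `((x, m), i)` with `x < m` and `i < size m`
(whatever the oracle). [folklore] -/
theorem mem_queryList_splitStepM {O : Oracle} {m X : ℕ} {q : List Bool}
    (hq : q ∈ queryList O (splitStepM m X)) :
    ∃ x i : ℕ, x < m ∧ i < m.size ∧ q = orderQueryEncoding.encode ((x, m), i) := by
  unfold splitStepM at hq
  by_cases he : Even m
  · simp [he] at hq
  simp only [if_neg he] at hq
  by_cases hpp : ppBase m < m
  · simp [hpp] at hq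
  simp only [if_neg hpp] at hq
  by_cases h3 : X % 2 ^ m.size = 0 ∨ m ≤ X % 2 ^ m.size
  · simp [h3] at hq
  simp only [if_neg h3] at hq
  by_cases hg : 1 < Nat.gcd (X % 2 ^ m.size) m
  · simp [hg] at hq
  simp only [if_neg hg] at hq
  rw [queryList_bind, queryList_pure', List.append_nil, queryList_orderQ] at hq
  simp only [List.mem_map, List.mem_range] at hq
  obtain ⟨i, hi, rfl⟩ := hq
  simp only [not_or, not_le] at h3
  exact ⟨X % 2 ^ m.size, i, h3.2, hi, rfl⟩

/-! ### The work-list machine, with the order from the oracle -/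

/-- Oracle version of one round `wstep` of the work-list machine. [folklore] -/
def wstepM (T : ℕ) (s : WState) (X : ℕ) : OracleComp WState :=
  match s.todo with
  | [] => OracleComp.pure s
  | (m, k) :: rest => OracleComp.bind (splitStepM m X) fun o =>
    OracleComp.pure (match o with
      | some d => ⟨s.done, (d, T) :: (m / d, T) :: rest⟩
      | none => if k ≤ 1 then ⟨m :: s.done, rest⟩ else ⟨s.done, (m, k - 1) :: rest⟩)

/-- One round agrees with `wstep` under the order-bit oracle. [folklore] -/
theorem eval_wstepM (T : ℕ) (s : WState) (X : ℕ) :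
    eval (Oracle.ofLanguage orderBitLang) (wstepM T s X) = wstep T s X := by
  unfold wstepM wstep
  rcases hs : s.todo with _ | ⟨⟨m, k⟩, rest⟩
  · rfl
  · simp only [eval_bind, eval, eval_splitStepM]
    rcases splitStep m X with _ | d <;> rfl

/-- One round asks at most `size m` queries, `m` the top of the stack (none if it is empty).
[folklore] -/
theorem queryCount_wstepM_le (O : Oracle) (T : ℕ) (s : WState) (X : ℕ) {B : ℕ}
    (hB : ∀ e ∈ s.todo.head?, e.1.size ≤ B) : queryCount O (wstepM T s X) ≤ B := by
  unfold wstepM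
  rcases hs : s.todo with _ | ⟨⟨m, k⟩, rest⟩
  · simp [queryCount]
  · simp only [queryCount_bind, queryCount, add_zero]
    exact (queryCount_splitStepM_le O m X).trans (hB (m, k) (by simp [hs]))

/-- The queries of one round are those of the attempt on the top of the stack. [folklore] -/
theorem mem_queryList_wstepM {O : Oracle} {T : ℕ} {s : WState} {X : ℕ} {q : List Bool}
    (hq : q ∈ queryList O (wstepM T s X)) :
    ∃ e ∈ s.todo.head?, ∃ x i : ℕ, x < e.1 ∧ i < e.1.size ∧ q = orderQueryEncoding.encode ((x, e.1), i) := by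
  unfold wstepM at hq
  rcases hs : s.todo with _ | ⟨⟨m, k⟩, rest⟩
  · simp [hs] at hq
  · simp only [hs] at hq
    rw [queryList_bind, queryList_pure', List.append_nil] at hq
    obtain ⟨x, i, hx, hi, rfl⟩ := mem_queryList_splitStepM hq
    exact ⟨(m, k), by simp, x, i, hx, hi, rfl⟩

/-- Oracle version of `wrun`: `t` rounds, round `i` consuming the block value `X i`. [folklore] -/
def wrunM (T : ℕ) (X : ℕ → ℕ) (s₀ : WState) : ℕ → OracleComp WState
  | 0 => OracleComp.pure s₀
  | t + 1 => OracleComp.bind (wrunM T X s₀ t) fun s => wstepM T s (X t)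

/-- The rounds agree with `wrun` under the order-bit oracle. [folklore] -/
theorem eval_wrunM (T : ℕ) (X : ℕ → ℕ) (s₀ : WState) (t : ℕ) :
    eval (Oracle.ofLanguage orderBitLang) (wrunM T X s₀ t) = wrun T X s₀ t := by
  induction t with
  | zero => rfl
  | succ t ih => simp only [wrunM, eval_bind, ih, eval_wstepM, wrun_succ]

/-- Under the order-bit oracle, started from `winit n T` with `1 < n`, `t` rounds ask at most
`t * size n` queries (every number on the stack divides `n`, invariant `Inv1`). [folklore] -/
theorem queryCount_wrunM_le {n : ℕ} (hn : 1 < n) (T : ℕ) (X : ℕ → ℕ) (t : ℕ) :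
    queryCount (Oracle.ofLanguage orderBitLang) (wrunM T X (winit n T) t) ≤ t * n.size := by
  induction t with
  | zero => simp [wrunM]
  | succ t ih =>
    simp only [wrunM, queryCount_bind, eval_wrunM, Nat.succ_mul]
    refine Nat.add_le_add ih (queryCount_wstepM_le _ _ _ _ fun e he => ?_)
    have h1 := inv1_wrun (T := T) (X := X) (inv1_winit hn T) t
    have hmem : e.1 ∈ (wrun T X (winit n T) t).entries := by
      unfold WState.entries
      refine List.mem_append_right _ (List.mem_map.2 ⟨e, ?_, rfl⟩)
      exact List.mem_of_mem_head? he
    exact Nat.size_le_size (Nat.le_of_dvd (by omega) (h1.dvd_of_mem hmem))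

/-- Under the order-bit oracle, started from `winit n T` with `1 < n`, every query of the rounds
is an order-bit query `((x, m), i)` with `x < m ≤ n` and `i < size m`. [folklore] -/
theorem mem_queryList_wrunM {n : ℕ} (hn : 1 < n) (T : ℕ) (X : ℕ → ℕ) (t : ℕ) {q : List Bool}
    (hq : q ∈ queryList (Oracle.ofLanguage orderBitLang) (wrunM T X (winit n T) t)) :
    ∃ x m i : ℕ, x < m ∧ m ≤ n ∧ i < m.size ∧ q = orderQueryEncoding.encode ((x, m), i) := by
  induction t with
  | zero => simp [wrunM] at hq
  | succ t ih =>
    simp only [wrunM] at hq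
    rw [queryList_bind, List.mem_append] at hq
    rcases hq with hq | hq
    · exact ih hq
    · rw [eval_wrunM] at hq
      obtain ⟨e, he, x, i, hx, hi, rfl⟩ := mem_queryList_wstepM hq
      have h1 := inv1_wrun (T := T) (X := X) (inv1_winit hn T) t
      have hmem : e.1 ∈ (wrun T X (winit n T) t).entries := by
        unfold WState.entries
        exact List.mem_append_right _ (List.mem_map.2 ⟨e, List.mem_of_mem_head? he, rfl⟩)
      exact ⟨x, e.1, i, hx, Nat.le_of_dvd (by omega) (h1.dvd_of_mem hmem), hi, rfl⟩

/-! ### The driver and the classical part -/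

/-- Oracle version of the driver `shorDriver`. [cite: Shor1997SICOMP, §5 p.16 (the reduction, repeated and recursed)] -/
def shorDriverM (n T R : ℕ) (X : ℕ → ℕ) : OracleComp (List ℕ) :=
  if n ≤ 1 then OracleComp.pure []
  else OracleComp.bind (wrunM T X (winit n T) R) fun s => OracleComp.pure (s.done.insertionSort (· ≤ ·))

/-- The driver agrees with `shorDriver` under the order-bit oracle. [folklore] -/
theorem eval_shorDriverM (n T R : ℕ) (X : ℕ → ℕ) :
    eval (Oracle.ofLanguage orderBitLang) (shorDriverM n T R X) = shorDriver n T R X := by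
  unfold shorDriverM shorDriver
  split_ifs with h
  · rfl
  · simp only [eval_bind, eval, eval_wrunM]

/-- Oracle version of `shorClassicalPair`. [cite: Shor1997SICOMP, §5 pp.15–16 (the classical reduction around order finding)] -/
def shorCompPair (x c : List Bool) : OracleComp (List Bool) :=
  OracleComp.bind
    (shorDriverM (decodeNat x) (budget x.length) (rounds x.length)
      (Xof (coinBlocks (rounds x.length) (blockLen x.length) c)))
    fun l => OracleComp.pure (encodingListNatBool.encode l)

/-- **The classical part of Shor's algorithm as an oracle computation** relative to the
order-bit oracle: `shorClassical`, with every order obtained by bit queries to the oracle.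
[cite: Shor1997SICOMP, §5 pp.15–16 (the classical reduction around order finding)] -/
def shorComp (w : List Bool) : OracleComp (List Bool) :=
  shorCompPair (boolUnpair w).1 (boolUnpair w).2

/-- **Correctness**: answered by the order-bit oracle, `shorComp` computes `shorClassical`.
[cite: Shor1997SICOMP, §5 pp.15–16 (the classical reduction around order finding)] -/
theorem eval_shorComp (w : List Bool) :
    eval (Oracle.ofLanguage orderBitLang) (shorComp w) = shorClassical w := by
  simp only [shorComp, shorCompPair, eval_bind, eval, eval_shorDriverM, shorClassical, shorClassicalPair]

/-- **Query count**: `shorComp w` asks at most `64 (L+1)³` queries, `L` the length of the first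
component of `w`. [folklore] -/
theorem queryCount_shorComp_le (w : List Bool) :
    queryCount (Oracle.ofLanguage orderBitLang) (shorComp w) ≤ 64 * ((boolUnpair w).1.length + 1) ^ 3 := by
  simp only [shorComp, shorCompPair, queryCount_bind, queryCount, add_zero]
  set x := (boolUnpair w).1
  unfold shorDriverM
  split_ifs with h
  · simp [queryCount]
  · simp only [queryCount_bind, queryCount, add_zero]
    refine (queryCount_wrunM_le (by omega) _ _ _).trans ?_
    have hsize : (decodeNat x).size ≤ x.length + 1 := Nat.size_le.2 (decodeNat_lt x)
    calc rounds x.length * (decodeNat x).size ≤ rounds x.length * (x.length + 1) :=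
          Nat.mul_le_mul_left _ hsize
      _ = 64 * (x.length + 1) ^ 3 := by unfold rounds; ring

/-- **Query length**: every query of `shorComp w` has length at most `7L + 13`. [folklore] -/
theorem length_le_of_mem_queryList_shorComp (w : List Bool) {q : List Bool}
    (hq : q ∈ queryList (Oracle.ofLanguage orderBitLang) (shorComp w)) :
    q.length ≤ 7 * (boolUnpair w).1.length + 13 := by
  simp only [shorComp, shorCompPair] at hq
  set x := (boolUnpair w).1
  rw [queryList_bind, queryList_pure', List.append_nil] at hq
  unfold shorDriverM at hq
  split_ifs at hq with h
  · simp [queryList] at hq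
  · rw [queryList_bind, queryList_pure', List.append_nil] at hq
    obtain ⟨x', m, i, hx', hm, hi, rfl⟩ := mem_queryList_wrunM (by omega) _ _ _ hq
    have hL : decodeNat x < 2 ^ (x.length + 1) := decodeNat_lt x
    have hm' : (encodeNat m).length ≤ x.length + 1 := length_encodeNat_le_of_lt (by omega)
    have hx'' : (encodeNat x').length ≤ x.length + 1 := length_encodeNat_le_of_lt (by omega)
    have hi' : (encodeNat i).length ≤ x.length + 1 := by
      rw [length_encodeNat]
      have : i.size ≤ i := by
        rcases Nat.eq_zero_or_pos i with rfl | hi0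
        · simp
        · exact Nat.size_le.2 (Nat.lt_two_pow_self)
      have : m.size ≤ x.length + 1 := Nat.size_le.2 (by omega)
      omega
    change (boolPair (boolPair (encodeNat x') (encodeNat m)) (encodeNat i)).length ≤ _
    simp only [length_boolPair]
    omega

/-! ### The programming fact and the reduction of `shorClassical_mem_FPRel` to it -/

/-- **Programming fact** (the machine half of `shorClassical_mem_FPRel`): the transcript step
function of `shorComp` — on `⟨w, answers⟩`, replay the classical part on `w`, consuming one
recorded answer per order-bit query, and report the next query or the output — is
polynomial-time computable (`OracleAlg.IsPolyTime`: Mathlib-`TM2` polynomial time on the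
`boolPair`-encoded pair). Its ingredients are binary parsing, parity, integer roots (perfect
powers), `gcd`, modular exponentiation and sorting, all polynomial time (Shor 1997, §5: the
classical parts of the algorithm are polynomial time). [cite: Shor1997SICOMP, §5 pp.15–16 (classical parts of the algorithm are polynomial time)] -/
def shorComp_isPolyTime : Prop :=
  (toOracleAlg shorComp).IsPolyTime (encodingList Bool)

/-- The resource polynomial of the oracle algorithm: rounds `> 64 (L+1)³` and query length
`≤ 7L + 13`. [folklore] -/
noncomputable def shorCompPoly : Polynomial ℕ := 64 * (Polynomial.X + 1) ^ 3 + 7 * Polynomial.X + 14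

/-- Evaluation of the resource polynomial. [folklore] -/
theorem shorCompPoly_eval (L : ℕ) : shorCompPoly.eval L = 64 * (L + 1) ^ 3 + 7 * L + 14 := by
  simp [shorCompPoly]

end Shor1997

/-- **`shorClassical ∈ FP^{orderBitLang}` from the programming fact.** The oracle algorithm is
the transcript step function of `Shor1997.shorComp`; by `OracleComp.run_toOracleAlg` its run
returns `eval = shorClassical` (`Shor1997.eval_shorComp`) within `64 (L+1)³ + 1` rounds
(`Shor1997.queryCount_shorComp_le`), and by `OracleComp.queries_toOracleAlg` its queries are
the order-bit queries, of length `≤ 7L + 13` (`Shor1997.length_le_of_mem_queryList_shorComp`).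
[cite: Shor1997SICOMP, §5 pp.15–16 (classical parts of the algorithm are polynomial time)] -/
theorem shorClassical_mem_FPRel_of (h : Shor1997.shorComp_isPolyTime) : shorClassical_mem_FPRel := by
  refine ⟨toOracleAlg Shor1997.shorComp, h, Shor1997.shorCompPoly, fun w => ?_⟩
  have hx : (boolUnpair w).1.length ≤ w.length := length_boolUnpair_fst_le w
  have hcube : ((boolUnpair w).1.length + 1) ^ 3 ≤ (w.length + 1) ^ 3 :=
    Nat.pow_le_pow_left (by omega) 3
  have hcount : queryCount (Oracle.ofLanguage orderBitLang) (Shor1997.shorComp w) <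
      Shor1997.shorCompPoly.eval w.length := by
    rw [Shor1997.shorCompPoly_eval]
    have := Shor1997.queryCount_shorComp_le w
    have : 64 * ((boolUnpair w).1.length + 1) ^ 3 ≤ 64 * (w.length + 1) ^ 3 := Nat.mul_le_mul_left _ hcube
    omega
  refine ⟨?_, fun y hy => ?_⟩
  · rw [run_toOracleAlg _ _ _ hcount, Shor1997.eval_shorComp]
  · rw [queries_toOracleAlg _ _ _ hcount] at hy
    have := Shor1997.length_le_of_mem_queryList_shorComp w hy
    rw [Shor1997.shorCompPoly_eval]
    have : 0 ≤ (w.length + 1) ^ 3 := Nat.zero_le _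
    omega

end Literature.Computability.Cryptography
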